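import Literature.NumberTheory.EllipticCurves.CMNewformGamma0LevelSquarefull
import Literature.NumberTheory.EllipticCurves.NewformGaloisRepInertiaInvariants
import Literature.NumberTheory.EllipticCurves.NewformsLiftProofs
import HarnessLib

/-!
# Sketch_sidea_k2_g27 — stub `stub_cmLambdaLower` (crux 26074, RSL_g 22608), k2 = literature transfer

D9 («CM purity of `V_g` at `v ∣ M`», the one print input that row 89 / S134 books for the PORT inside
child B of the KZ_g hold 24105) is DISCHARGED on the RTT habitat by two things already on the record:
RSL_g's own print atom LVsq (`cmNewform_gamma0_sq_dvd_level`, stub `stub_cmLevelSquarefull`) and the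
TREE's named fact `Carayol1986_finrank_inertiaInvariants` (clause 2: `a_ℓ(g) = 0 ⇒ V^{I_𝔔} = ⊥`),
plus kernel linear algebra (§3: rank–nullity `rank H¹(I_v,T) = dim V^{I_v}`, so Kato's local term is FINITE;
§2: in `SL₂`, no fixed vector ⇒ no fixed covector, i.e. `V^{I} = 0 ⇒ V_{I} = 0`, the coinvariant reading).
No purity / Weil weight / Grössencharakter enters.  MODEL/GLUE lemmas only: nothing here proves RSL_g,
the crux, child A/B or S3″; BSD is proved for no curve.  No `def`, no `instance`, no `sorry`.
-/

set_option autoImplicit false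
set_option linter.dupNamespace false

noncomputable section

open scoped MatrixGroups Matrix NumberField ModularForm
open Matrix CongruenceSubgroup IsDedekindDomain Field NumberField
open Literature.NumberTheory.EllipticCurves Literature.NumberTheory.EllipticCurves.ModularForms
open Literature.NumberTheory.GaloisRepresentations Literature.NumberTheory.Automorphic

namespace Summit.BirchSwinnertonDyer.BirchSwinnertonDyer.Cruxes.ResidualThetaCountLowerPureAtTwo.SideaK2G27

/-! ## §1  D9 at the level of inertia INVARIANTS: `V^{I_𝔔} = 0` at every `ℓ ∣ M`, `ℓ ≠ p`,
for a CM newform on `Γ₀(M)` — from LVsq (print atom of RSL_g) and Carayol (tree named fact). -/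

/-- **LV0 from LVsq** (the form the Carayol fact consumes): a CM newform on `Γ₀(M)` has
`a_ℓ = 0` at every level prime, stated on the `Γ₁(M)`-lift's `q`-expansion. -/
theorem qExpansion_coeff_liftToGamma1_eq_zero_of_cm
    (hLV : cmNewform_gamma0_sq_dvd_level)
    {M : ℕ} [NeZero M] (g : CuspForm (Gamma0 M) 2) (hg : IsNewform0 g)
    (hcm : IsCMForm (liftToGamma1 M 2 g)) {ℓ : ℕ} (hℓ : ℓ.Prime) (hℓM : ℓ ∣ M) :
    (UpperHalfPlane.qExpansion 1 ⇑(liftToGamma1 M 2 g)).coeff ℓ = 0 := by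
  have h0 : cuspCoeff g ℓ = 0 :=
    (hg.cuspCoeff_eq_zero_iff_sq_dvd hℓ hℓM).2 (hLV M g hg hcm ℓ hℓ hℓM)
  rw [coe_liftToGamma1_holds M 2 g]
  exact h0

/-- **D9 discharged (invariants form).**  For a weight-two CM newform `g` on `Γ₀(M)`, any prime `p`,
`ι : ℚ̄_p ≃ ℂ`, any irreducible `ρ : Γ_ℚ → GL₂(ℚ̄_p)` attached to (the `Γ₁`-lift of) `g` away from `Mp`,
and any level prime `ℓ ∣ M`, `ℓ ≠ p`: the inertia group at every `𝔔 ∣ ℓ` has NO non-zero invariant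
on `ρ` — `V^{I_𝔔} = ⊥`.  Inputs: LVsq (`hLV`, RSL_g's print stub `stub_cmLevelSquarefull`) and
Carayol 1986 Thm (A) in the tree's inertia-invariants form (`hCar`).  On the RTT habitat
(`M` odd, `p = 2`) this is every `v ∣ M`. -/
theorem inertiaInvariants_eq_bot_of_cmNewform_gamma0
    (hLV : cmNewform_gamma0_sq_dvd_level) (hCar : Carayol1986_finrank_inertiaInvariants)
    {M : ℕ} [NeZero M] (g : CuspForm (Gamma0 M) 2) (hg : IsNewform0 g)
    (hcm : IsCMForm (liftToGamma1 M 2 g))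
    (p : ℕ) [Fact p.Prime] (ι : PadicAlgCl p ≃+* ℂ) (ρ : FramedGaloisRep ℚ (PadicAlgCl p) 2)
    (hρ : IsGaloisRepOfNewform1 (liftToGamma1 M 2 g)
      ((ι.symm : ℂ →+* PadicAlgCl p).comp (algebraMap (coeffCharField (liftToGamma1 M 2 g)) ℂ))
      {q | q ∣ M * p} ρ)
    (hirr : ρ.toGaloisRep.IsIrreducible)
    {ℓ : ℕ} (hℓ : ℓ.Prime) (hℓp : ℓ ≠ p) (hℓM : ℓ ∣ M)
    (w : HeightOneSpectrum (𝓞 ℚ)) (hw : (ℓ : 𝓞 ℚ) ∈ w.asIdeal) :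
    ∀ 𝔔 ∈ w.primesAbove,
      ρ.toGaloisRep.fixedSubmodule (𝔔.inertia (absoluteGaloisGroup ℚ)) = ⊥ := by
  intro 𝔔 h𝔔
  have hg1 : IsNewform1 (liftToGamma1 M 2 g) := (isNewform1_liftToGamma1_iff_holds M 2 g).mpr hg
  exact (hCar (liftToGamma1 M 2 g) le_rfl hg1 p ι ρ hρ hirr ℓ hℓ hℓp hℓM w hw 𝔔 h𝔔).2
    (qExpansion_coeff_liftToGamma1_eq_zero_of_cm hLV g hg hcm hℓ hℓM)

/-! ## §2  From invariants to COINVARIANTS in kernel: in `SL₂` a fixed covector gives a fixed vector.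
For `H = ρ(I_v) ⊂ SL₂` (`det ρ_g = χ_cyc` on `Γ₀`, unramified at `v ∤ 2`): `V^{H} = 0 ⇒ (V^*)^{H} = 0`,
i.e. `(V_H)^* = 0`, i.e. `V_H = 0` — so `(T_ρ)_{I_v}` is finite and D9's eigenvalue clause is EMPTY. -/

/-- In `SL₂(R)`: if the row vector `w` is fixed by `A` (`w A = w`) then the column vector
`(w₁, -w₀)` is fixed by `A` (`A v = v`).  (`A⁻¹ = adj A`; `J Aᵀ J⁻¹ = adj A`.) -/
theorem mulVec_eq_of_vecMul_eq_of_det_eq_one {R : Type*} [CommRing R]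
    (A : Matrix (Fin 2) (Fin 2) R) (hA : A.det = 1) (w : Fin 2 → R) (hw : Matrix.vecMul w A = w) :
    A.mulVec ![w 1, -w 0] = ![w 1, -w 0] := by
  have h0 := congrFun hw 0
  have h1 := congrFun hw 1
  simp only [Matrix.vecMul, dotProduct, Fin.sum_univ_two] at h0 h1
  rw [Matrix.det_fin_two] at hA
  ext i
  fin_cases i
  · simp [Matrix.mulVec, dotProduct, Fin.sum_univ_two]
    linear_combination (w 1) * hA + (A 0 1) * h0 - (A 0 0) * h1
  · simp [Matrix.mulVec, dotProduct, Fin.sum_univ_two]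
    linear_combination (-(w 0)) * hA + (A 1 1) * h0 - (A 1 0) * h1

/-- **No fixed vector ⇒ no fixed covector** for any family of determinant-one `2 × 2` matrices
(e.g. `ρ(I_v)`): the invariant functionals — the dual of the COINVARIANTS — vanish as soon as
the invariants do.  With §1 this gives `V_{I_v} = 0` for `V = V_{g,λ} ⊗ ℚ̄₂`, `v ∣ M`. -/
theorem vecMul_fixed_eq_zero_of_mulVec_fixed_eq_zero {R : Type*} [CommRing R] {ι : Type*}
    (A : ι → Matrix (Fin 2) (Fin 2) R) (hdet : ∀ i, (A i).det = 1)
    (hfix : ∀ v : Fin 2 → R, (∀ i, (A i).mulVec v = v) → v = 0)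
    (w : Fin 2 → R) (hw : ∀ i, Matrix.vecMul w (A i) = w) : w = 0 := by
  have hv : (![w 1, -w 0] : Fin 2 → R) = 0 :=
    hfix _ fun i ↦ mulVec_eq_of_vecMul_eq_of_det_eq_one (A i) (hdet i) w (hw i)
  have e0 := congrFun hv 0
  have e1 := congrFun hv 1
  simp at e0 e1
  ext j
  fin_cases j
  · simpa using e1
  · simpa using e0

/-- Converse direction (for completeness, so that `V^{H} = 0 ↔ (V^*)^{H} = 0` in `SL₂`): a fixed
column vector `v` gives the fixed row vector `(v₁, -v₀)`. -/
theorem vecMul_eq_of_mulVec_eq_of_det_eq_one {R : Type*} [CommRing R]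
    (A : Matrix (Fin 2) (Fin 2) R) (hA : A.det = 1) (v : Fin 2 → R) (hv : A.mulVec v = v) :
    Matrix.vecMul ![v 1, -v 0] A = ![v 1, -v 0] := by
  have h0 := congrFun hv 0
  have h1 := congrFun hv 1
  simp only [Matrix.mulVec, dotProduct, Fin.sum_univ_two] at h0 h1
  rw [Matrix.det_fin_two] at hA
  ext j
  fin_cases j
  · simp [Matrix.vecMul, dotProduct, Fin.sum_univ_two]
    linear_combination (v 1) * hA + (A 1 0) * h0 - (A 0 0) * h1
  · simp [Matrix.vecMul, dotProduct, Fin.sum_univ_two]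
    linear_combination (-(v 0)) * hA + (A 1 1) * h0 - (A 0 1) * h1

/-! ## §3  The rank identity behind D9′ (E3): `rank H¹(I_v, T) = dim V^{I_v}`.
After the pro-`2′` dévissage (E1) and the procyclic formula `H¹(ℤ₂·τ, N) = N/(τ-1)N` (E2), Kato's local
term at `v ∣ M` is the COKERNEL of `τ - 1` on `U := V^{H₀}` while the inertia invariants are its KERNEL;
rank–nullity makes them equidimensional, so `V^{I_v} = 0` (§1) ⇒ `H¹(I_v, T_ρ)` finite — no eigenvalue,
no purity. -/

/-- **E3.** For an endomorphism `φ` (`= τ - 1`) of a finite-dimensional space, `coker φ` and `ker φ`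
have the same dimension. -/
theorem finrank_quotient_range_eq_finrank_ker {K V : Type*} [Field K] [AddCommGroup V]
    [Module K V] [FiniteDimensional K V] (φ : V →ₗ[K] V) :
    Module.finrank K (V ⧸ LinearMap.range φ) = Module.finrank K (LinearMap.ker φ) := by
  have h1 := LinearMap.finrank_range_add_finrank_ker φ
  have h2 := Submodule.finrank_quotient_add_finrank (LinearMap.range φ)
  omega

/-- **E3, the form D9′ consumes.** If `τ` has no non-zero fixed vector on `U` (`U^{τ} = 0`, i.e.
`V^{I_v} = 0`), then `τ - 1` is onto: the coinvariant quotient `U/(τ-1)U` (`= H¹(I_v, V)`) is zero. -/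
theorem range_sub_one_eq_top_of_fixed_eq_zero {K V : Type*} [Field K] [AddCommGroup V]
    [Module K V] [FiniteDimensional K V] (τ : V →ₗ[K] V) (h : ∀ v : V, τ v = v → v = 0) :
    LinearMap.range (τ - 1) = ⊤ := by
  refine LinearMap.ker_eq_bot_iff_range_eq_top.mp ?_
  refine LinearMap.ker_eq_bot'.mpr fun v hv ↦ h v ?_
  have : τ v - v = 0 := by simpa [LinearMap.sub_apply] using hv
  exact sub_eq_zero.mp this

end Summit.BirchSwinnertonDyer.BirchSwinnertonDyer.Cruxes.ResidualThetaCountLowerPureAtTwo.SideaK2G27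

end
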